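import Summits.MatrixMultiplication.OmegaCensus.STPP222PentaOrder72
import Literature.Combinatorics.Additive.SliceRankMethod
import Mathlib.Logic.Equiv.Fin.Basic

/-!
# STPP families times tricolored sum-free sets: the product mechanism and a sub-quadratic `(2,2,2)^k` law

Cell `pub-omega`, STPP track (family b′), seat pub-omega-stpp-2 (gen 6). HONEST FRAMING: lottery ticket; floor =
certified bounds/negative ranges. Census STRUCTURE bookkeeping for question Q7 (the onset `n_k` of `k` simultaneous-TPP
triples of 2-subsets); a `(2,2,2)^k` STPP family yields no matrix-multiplication bound of interest, and nothing here is
progress on `ω`.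

* `isSTPP_prodTSF` — **product mechanism** (the singleton case of the CKSU product of STPP families): if
  `(Aᵢ, Bᵢ, Cᵢ)_{i<N}` is an STPP family in `H₁` and `(σⱼ, τⱼ, υⱼ)_{j<k}` is a tricolored sum-free set in `H₂` (tree
  `IsTricoloredSumFree`, BCCGNSU 2017 Def. 3.1), then the `N·k` triples `(Aᵢ × {0}, Bᵢ × {τⱼ + υⱼ}, Cᵢ × {υⱼ})` form an STPP
  family in `H₁ × H₂` with the same set sizes: the `H₂`-component of the defining word is `σ_{i'} + τ_{j'} + υ_{k'}`.
* `exists_isSTPP_222pow_mul_of_tsf` — hence `(2,2,2)^N ⊆ H₁` and a `k`-element tricolored sum-free set in `H₂` give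
  `(2,2,2)^{N·k} ⊆ H₁ × H₂`; in census notation `n_{N·k} ≤ n_N · t(k)` with `t(k)` the least order of an abelian group with a
  `k`-element tricolored sum-free set.
* Instances from cap sets (a cap set `S ⊆ 𝔽₃^m` is tricolored sum-free with `σ = τ = υ`):
  `exists_isTSF_nine_zmod3_cube` (`|S| = 9` in `𝔽₃³`), `exists_isTSF_twenty_zmod3_pow4` (`|S| = 20` in `𝔽₃⁴`), whence `(2,2,2)⁹ ⊆ (ℤ/2)³ × (ℤ/3)³` (order `216`), `(2,2,2)²⁰ ⊆ (ℤ/2)³ × (ℤ/3)⁴`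
  (order `648`), `(2,2,2)⁴⁵ ⊆ ((ℤ/2)³ × (ℤ/3)²) × (ℤ/3)³` (order `1944`), `(2,2,2)¹⁰⁰ ⊆ ((ℤ/2)³ × (ℤ/3)²) × (ℤ/3)⁴` (order
  `5832`) — each far below the tree's cyclic law `8k² − 8k + 8` (`584, 3048, 15848, 79208`), so the kernel UPPER law for
  the onset is sub-quadratic along these `k` (cap sets of size `≍ 2.2^m` in `3^m` give `n_k = O(k^{log 24 / log 2.2…})`;
  no optimality is claimed: the census onsets `n₂..n₅ = 24, 40, 56, ≤ 72` are of this product form only at `k = 2`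
  (`(ℤ/2)³ × ℤ/3`): the least orders of abelian groups with a tricolored sum-free set of size `2, 3, 4` are `3, 7, 9` and
  none of order `≤ 12` has one of size `5` — seat search ×1, quoted for orientation only, not used here).

References: H. Cohn, R. Kleinberg, B. Szegedy, C. Umans, FOCS 2005 (arXiv:math/0511460), Def. 5.1 and the product lemma
for simultaneous TPP families; J. Blasiak, T. Church, H. Cohn, J. A. Grochow, E. Naslund, W. F. Sawin, C. Umans,
Discrete Analysis 2017:3, Def. 3.1 (tricolored sum-free sets), §4 (cap sets are tricolored sum-free).
-/

open Literature.Computability.AlgebraicComplexity Literature.Combinatorics.Additive Finset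

namespace Summit.MatrixMultiplication.OmegaCensus

section Product

variable {H₁ H₂ : Type*} {N k : ℕ}

variable [AddCommGroup H₁] [AddCommGroup H₂]

/-- **STPP × tricolored-sum-free product.** If `(A, B, C)` is an STPP family in `H₁` (`N` triples) and `(σ, τ, υ)` is a
tricolored sum-free set of size `k` in `H₂`, then the `N·k` triples `(Aᵢ × {0}, Bᵢ × {τⱼ + υⱼ}, Cᵢ × {υⱼ})` form an STPP
family in `H₁ × H₂`.  Proof: the second component of the defining word `(s' − s) + (t' − t) + (u' − u)` equals
`σ_{i'} + τ_{j'} + υ_{k'}` for the three second indices (using `σⱼ + τⱼ + υⱼ = 0`), so they coincide; then the first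
component is the defining word of `(A, B, C)`. [cite: CohnKleinbergSzegedyUmans2005, Def. 5.1]
[cite: BlasiakChurchCohnGrochowNaslundSawinUmans2017, Def. 3.1] -/
theorem isSTPP_prodTSF {A B C : Fin N → Finset H₁} (hS : IsSTPP A B C) {σ τ υ : Fin k → H₂}
    (hT : IsTricoloredSumFree σ τ υ) :
    IsSTPP (fun m : Fin (N * k) => A (finProdFinEquiv.symm m).1 ×ˢ ({(0 : H₂)} : Finset H₂))
      (fun m => B (finProdFinEquiv.symm m).1 ×ˢ {τ (finProdFinEquiv.symm m).2 + υ (finProdFinEquiv.symm m).2})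
      (fun m => C (finProdFinEquiv.symm m).1 ×ˢ {υ (finProdFinEquiv.symm m).2}) := by
  intro i j l s hs s' hs' t ht t' ht' u hu u' hu' h0
  simp only [mem_product, mem_singleton] at hs hs' ht ht' hu hu'
  obtain ⟨hs1, hs2⟩ := hs
  obtain ⟨hs1', hs2'⟩ := hs'
  obtain ⟨ht1, ht2⟩ := ht
  obtain ⟨ht1', ht2'⟩ := ht'
  obtain ⟨hu1, hu2⟩ := hu
  obtain ⟨hu1', hu2'⟩ := hu'
  have h1 : (s'.1 - s.1) + (t'.1 - t.1) + (u'.1 - u.1) = 0 := by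
    have := congrArg Prod.fst h0; simpa using this
  have h2 : (s'.2 - s.2) + (t'.2 - t.2) + (u'.2 - u.2) = 0 := by
    have := congrArg Prod.snd h0; simpa using this
  -- second indices
  set i₂ := (finProdFinEquiv.symm i).2 with hi₂
  set j₂ := (finProdFinEquiv.symm j).2 with hj₂
  set l₂ := (finProdFinEquiv.symm l).2 with hl₂
  have hσi : σ i₂ = -(τ i₂ + υ i₂) := by
    have := hT.sum_eq_zero i₂
    rw [eq_neg_iff_add_eq_zero, ← add_assoc]; exact this
  have hE : σ i₂ + τ j₂ + υ l₂ = 0 := by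
    rw [hs2, hs2', ht2, ht2', hu2, hu2'] at h2
    rw [hσi]
    have : -(τ i₂ + υ i₂) + τ j₂ + υ l₂ = (0 - 0) + ((τ j₂ + υ j₂) - (τ i₂ + υ i₂)) + (υ l₂ - υ j₂) := by abel
    rw [this, h2]
  obtain ⟨hij₂, hjl₂⟩ := (hT i₂ j₂ l₂).1 hE
  -- first indices and letters
  obtain ⟨hij₁, hjl₁, hss, htt, huu⟩ := hS _ _ _ s.1 hs1 s'.1 hs1' t.1 ht1 t'.1 ht1' u.1 hu1 u'.1 hu1' h1
  have hij : i = j := by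
    apply finProdFinEquiv.symm.injective; exact Prod.ext hij₁ hij₂
  have hjl : j = l := by
    apply finProdFinEquiv.symm.injective; exact Prod.ext hjl₁ hjl₂
  refine ⟨hij, hjl, Prod.ext hss ?_, Prod.ext htt ?_, Prod.ext huu ?_⟩
  · rw [hs2, hs2']
  · rw [ht2, ht2', hij₂]
  · rw [hu2, hu2', hjl₂]

/-- **`(2,2,2)^N ⊆ H₁` and a `k`-element tricolored sum-free set in `H₂` give `(2,2,2)^{N·k} ⊆ H₁ × H₂`.**
[cite: CohnKleinbergSzegedyUmans2005, Def. 5.1] [cite: BlasiakChurchCohnGrochowNaslundSawinUmans2017, Def. 3.1] -/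
theorem exists_isSTPP_222pow_mul_of_tsf
    (h1 : ∃ A B C : Fin N → Finset H₁, IsSTPP A B C ∧ ∀ i, (A i).card = 2 ∧ (B i).card = 2 ∧ (C i).card = 2)
    {σ τ υ : Fin k → H₂} (hT : IsTricoloredSumFree σ τ υ) :
    ∃ A B C : Fin (N * k) → Finset (H₁ × H₂), IsSTPP A B C ∧
      ∀ m, (A m).card = 2 ∧ (B m).card = 2 ∧ (C m).card = 2 := by
  obtain ⟨A, B, C, hS, hc⟩ := h1
  refine ⟨_, _, _, isSTPP_prodTSF hS hT, fun m => ?_⟩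
  simp only [card_product, card_singleton, mul_one]
  exact hc _

end Product

section CapSets

/-- **A 9-element tricolored sum-free set in `(ℤ/3)³`** — a 9-point cap set of `𝔽₃³` taken in all three colours
(kernel check of the `9³` sums). [cite: BlasiakChurchCohnGrochowNaslundSawinUmans2017, Def. 3.1] -/
theorem exists_isTSF_nine_zmod3_cube :
    ∃ v : Fin 9 → ZMod 3 × ZMod 3 × ZMod 3, IsTricoloredSumFree v v v :=
  ⟨![(0,0,0), (0,0,1), (0,1,0), (0,1,1), (1,0,0), (1,0,1), (1,1,2), (1,2,2), (2,1,2)], by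
    unfold IsTricoloredSumFree; decide⟩

/-- **A 20-element tricolored sum-free set in `(ℤ/3)⁴`** — a 20-point cap set of `𝔽₃⁴` (the maximum size, Pellegrino
1970) taken in all three colours (kernel check of the `20³` sums). [cite: BlasiakChurchCohnGrochowNaslundSawinUmans2017, Def. 3.1] -/
theorem exists_isTSF_twenty_zmod3_pow4 :
    ∃ v : Fin 20 → ZMod 3 × ZMod 3 × ZMod 3 × ZMod 3, IsTricoloredSumFree v v v :=
  ⟨![(0,0,0,0), (0,0,0,1), (0,0,1,0), (0,0,1,1), (0,1,0,0), (0,1,0,1), (0,1,1,0), (0,1,1,1), (1,0,0,0), (1,0,0,1),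
     (1,0,1,2), (1,0,2,2), (1,1,0,2), (1,2,0,2), (2,0,1,2), (2,1,0,2), (2,1,1,0), (2,1,1,1), (2,1,2,2), (2,2,1,2)], by
    unfold IsTricoloredSumFree; decide⟩

/-- **`(2,2,2)⁹` at order `216`:** `(ℤ/2)³ × (ℤ/3)³` carries nine simultaneous-TPP triples of 2-subsets (seed
`(2,2,2)¹ ⊆ (ℤ/2)³` times the 9-cap). [cite: CohnKleinbergSzegedyUmans2005, Def. 5.1] -/
theorem exists_isSTPP_222pow9_order216 :
    ∃ A B C : Fin (1 * 9) → Finset ((ZMod 2 × ZMod 2 × ZMod 2) × (ZMod 3 × ZMod 3 × ZMod 3)), IsSTPP A B C ∧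
      ∀ m, (A m).card = 2 ∧ (B m).card = 2 ∧ (C m).card = 2 :=
  by obtain ⟨v, hv⟩ := exists_isTSF_nine_zmod3_cube; exact exists_isSTPP_222pow_mul_of_tsf exists_isSTPP_222pow1_seed_2_2_2 hv

/-- **`(2,2,2)²⁰` at order `648`:** `(ℤ/2)³ × (ℤ/3)⁴` carries twenty simultaneous-TPP triples of 2-subsets.
[cite: CohnKleinbergSzegedyUmans2005, Def. 5.1] -/
theorem exists_isSTPP_222pow20_order648 :
    ∃ A B C : Fin (1 * 20) → Finset ((ZMod 2 × ZMod 2 × ZMod 2) × (ZMod 3 × ZMod 3 × ZMod 3 × ZMod 3)),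
      IsSTPP A B C ∧ ∀ m, (A m).card = 2 ∧ (B m).card = 2 ∧ (C m).card = 2 :=
  by obtain ⟨v, hv⟩ := exists_isTSF_twenty_zmod3_pow4; exact exists_isSTPP_222pow_mul_of_tsf exists_isSTPP_222pow1_seed_2_2_2 hv

/-- **`(2,2,2)⁴⁵` at order `1944`:** the order-72 penta seed times the 9-cap. [cite: CohnKleinbergSzegedyUmans2005, Def. 5.1] -/
theorem exists_isSTPP_222pow45_order1944 :
    ∃ A B C : Fin (5 * 9) → Finset ((ZMod 2 × ZMod 2 × ZMod 2 × ZMod 3 × ZMod 3) × (ZMod 3 × ZMod 3 × ZMod 3)),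
      IsSTPP A B C ∧ ∀ m, (A m).card = 2 ∧ (B m).card = 2 ∧ (C m).card = 2 :=
  by obtain ⟨v, hv⟩ := exists_isTSF_nine_zmod3_cube; exact exists_isSTPP_222pow_mul_of_tsf exists_isSTPP_222penta_seed_2_2_2_3_3 hv

/-- **`(2,2,2)¹⁰⁰` at order `5832`:** the order-72 penta seed times the 20-cap. [cite: CohnKleinbergSzegedyUmans2005, Def. 5.1] -/
theorem exists_isSTPP_222pow100_order5832 :
    ∃ A B C : Fin (5 * 20) → Finset ((ZMod 2 × ZMod 2 × ZMod 2 × ZMod 3 × ZMod 3) × (ZMod 3 × ZMod 3 × ZMod 3 × ZMod 3)),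
      IsSTPP A B C ∧ ∀ m, (A m).card = 2 ∧ (B m).card = 2 ∧ (C m).card = 2 :=
  by obtain ⟨v, hv⟩ := exists_isTSF_twenty_zmod3_pow4; exact exists_isSTPP_222pow_mul_of_tsf exists_isSTPP_222penta_seed_2_2_2_3_3 hv

/-- Orders of the four product groups: `216, 648, 1944, 5832`. -/
theorem card_prod_groups :
    Fintype.card ((ZMod 2 × ZMod 2 × ZMod 2) × (ZMod 3 × ZMod 3 × ZMod 3)) = 216 ∧
    Fintype.card ((ZMod 2 × ZMod 2 × ZMod 2) × (ZMod 3 × ZMod 3 × ZMod 3 × ZMod 3)) = 648 ∧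
    Fintype.card ((ZMod 2 × ZMod 2 × ZMod 2 × ZMod 3 × ZMod 3) × (ZMod 3 × ZMod 3 × ZMod 3)) = 1944 ∧
    Fintype.card ((ZMod 2 × ZMod 2 × ZMod 2 × ZMod 3 × ZMod 3) × (ZMod 3 × ZMod 3 × ZMod 3 × ZMod 3)) = 5832 := by
  simp only [Fintype.card_prod, ZMod.card]; norm_num

end CapSets

section SmallTSF

/-- A 2-element tricolored sum-free set in `ℤ/3` (all colours `{0, 1}`). [cite: BlasiakChurchCohnGrochowNaslundSawinUmans2017, Def. 3.1] -/
theorem exists_isTSF_two_zmod3 : ∃ v : Fin 2 → ZMod 3, IsTricoloredSumFree v v v :=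
  ⟨![0, 1], by unfold IsTricoloredSumFree; decide⟩

/-- A 3-element tricolored sum-free set in `ℤ/7`: `σ = τ = (0, 1, 3)`, `υ = (0, 5, 1)` (no abelian group of order `≤ 6`
has one — seat search, not used). [cite: BlasiakChurchCohnGrochowNaslundSawinUmans2017, Def. 3.1] -/
theorem exists_isTSF_three_zmod7 : ∃ σ τ υ : Fin 3 → ZMod 7, IsTricoloredSumFree σ τ υ :=
  ⟨![0, 1, 3], ![0, 1, 3], ![0, 5, 1], by unfold IsTricoloredSumFree; decide⟩

/-- A 4-element tricolored sum-free set in `(ℤ/3)²` (the 4-point cap set, all colours equal).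
[cite: BlasiakChurchCohnGrochowNaslundSawinUmans2017, Def. 3.1] -/
theorem exists_isTSF_four_zmod3_sq : ∃ v : Fin 4 → ZMod 3 × ZMod 3, IsTricoloredSumFree v v v :=
  ⟨![(0,0), (0,1), (1,0), (1,1)], by unfold IsTricoloredSumFree; decide⟩

/-- A 5-element tricolored sum-free set in `ℤ/13`: `σ = (0,1,2,6,9)`, `τ = (0,3,6,5,1)`, `υ = (0,9,5,2,3)` (no abelian group
of order `≤ 12` has one — seat search, not used). [cite: BlasiakChurchCohnGrochowNaslundSawinUmans2017, Def. 3.1] -/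
theorem exists_isTSF_five_zmod13 : ∃ σ τ υ : Fin 5 → ZMod 13, IsTricoloredSumFree σ τ υ :=
  ⟨![0, 1, 2, 6, 9], ![0, 3, 6, 5, 1], ![0, 9, 5, 2, 3], by unfold IsTricoloredSumFree; decide⟩

/-- **`(2,2,2)⁶` at order `120`:** the order-40 cube seed `(ℤ/2)³ × ℤ/5` times the 2-element TSF set of `ℤ/3`
(kernel upper bound for STRUCTURE Q7's row `k = 6`; the tree's cyclic law gives `248`). [cite: CohnKleinbergSzegedyUmans2005, Def. 5.1] -/
theorem exists_isSTPP_222pow6_order120 :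
    ∃ A B C : Fin (3 * 2) → Finset ((ZMod 2 × ZMod 2 × ZMod 2 × ZMod 5) × ZMod 3), IsSTPP A B C ∧
      ∀ m, (A m).card = 2 ∧ (B m).card = 2 ∧ (C m).card = 2 :=
  by obtain ⟨v, hv⟩ := exists_isTSF_two_zmod3; exact exists_isSTPP_222pow_mul_of_tsf exists_isSTPP_222cube_seed_2_2_2_5 hv

/-- **`(2,2,2)⁸` at order `168`:** the order-56 tetra seed `(ℤ/2)³ × ℤ/7` times the 2-element TSF set of `ℤ/3` (cyclic law: `456`).
[cite: CohnKleinbergSzegedyUmans2005, Def. 5.1] -/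
theorem exists_isSTPP_222pow8_order168 :
    ∃ A B C : Fin (4 * 2) → Finset ((ZMod 2 × ZMod 2 × ZMod 2 × ZMod 7) × ZMod 3), IsSTPP A B C ∧
      ∀ m, (A m).card = 2 ∧ (B m).card = 2 ∧ (C m).card = 2 :=
  by obtain ⟨v, hv⟩ := exists_isTSF_two_zmod3; exact exists_isSTPP_222pow_mul_of_tsf exists_isSTPP_222tetra_seed_2_2_2_7 hv

/-- **`(2,2,2)¹⁰` at order `216`:** the order-72 penta seed times the 2-element TSF set of `ℤ/3` (cyclic law: `728`).
[cite: CohnKleinbergSzegedyUmans2005, Def. 5.1] -/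
theorem exists_isSTPP_222pow10_order216 :
    ∃ A B C : Fin (5 * 2) → Finset ((ZMod 2 × ZMod 2 × ZMod 2 × ZMod 3 × ZMod 3) × ZMod 3), IsSTPP A B C ∧
      ∀ m, (A m).card = 2 ∧ (B m).card = 2 ∧ (C m).card = 2 :=
  by obtain ⟨v, hv⟩ := exists_isTSF_two_zmod3; exact exists_isSTPP_222pow_mul_of_tsf exists_isSTPP_222penta_seed_2_2_2_3_3 hv

/-- **`(2,2,2)¹²` at order `360`:** the order-40 cube seed times the 4-point cap set of `(ℤ/3)²` (cyclic law: `1064`).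
[cite: CohnKleinbergSzegedyUmans2005, Def. 5.1] -/
theorem exists_isSTPP_222pow12_order360 :
    ∃ A B C : Fin (3 * 4) → Finset ((ZMod 2 × ZMod 2 × ZMod 2 × ZMod 5) × (ZMod 3 × ZMod 3)), IsSTPP A B C ∧
      ∀ m, (A m).card = 2 ∧ (B m).card = 2 ∧ (C m).card = 2 :=
  by obtain ⟨v, hv⟩ := exists_isTSF_four_zmod3_sq; exact exists_isSTPP_222pow_mul_of_tsf exists_isSTPP_222cube_seed_2_2_2_5 hv

/-- **`(2,2,2)¹⁵` at order `504`:** the order-72 penta seed times the 3-element TSF set of `ℤ/7` (cyclic law: `1688`).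
[cite: CohnKleinbergSzegedyUmans2005, Def. 5.1] -/
theorem exists_isSTPP_222pow15_order504 :
    ∃ A B C : Fin (5 * 3) → Finset ((ZMod 2 × ZMod 2 × ZMod 2 × ZMod 3 × ZMod 3) × ZMod 7), IsSTPP A B C ∧
      ∀ m, (A m).card = 2 ∧ (B m).card = 2 ∧ (C m).card = 2 :=
  by obtain ⟨σ, τ, υ, h⟩ := exists_isTSF_three_zmod7; exact exists_isSTPP_222pow_mul_of_tsf exists_isSTPP_222penta_seed_2_2_2_3_3 h

/-- **`(2,2,2)¹⁶` at order `504`:** the order-56 tetra seed times the 4-point cap set of `(ℤ/3)²` (cyclic law: `1928`).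
[cite: CohnKleinbergSzegedyUmans2005, Def. 5.1] -/
theorem exists_isSTPP_222pow16_order504 :
    ∃ A B C : Fin (4 * 4) → Finset ((ZMod 2 × ZMod 2 × ZMod 2 × ZMod 7) × (ZMod 3 × ZMod 3)), IsSTPP A B C ∧
      ∀ m, (A m).card = 2 ∧ (B m).card = 2 ∧ (C m).card = 2 :=
  by obtain ⟨v, hv⟩ := exists_isTSF_four_zmod3_sq; exact exists_isSTPP_222pow_mul_of_tsf exists_isSTPP_222tetra_seed_2_2_2_7 hv

/-- **`(2,2,2)²⁵` at order `936`:** the order-72 penta seed times the 5-element TSF set of `ℤ/13` (cyclic law: `4808`).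
[cite: CohnKleinbergSzegedyUmans2005, Def. 5.1] -/
theorem exists_isSTPP_222pow25_order936 :
    ∃ A B C : Fin (5 * 5) → Finset ((ZMod 2 × ZMod 2 × ZMod 2 × ZMod 3 × ZMod 3) × ZMod 13), IsSTPP A B C ∧
      ∀ m, (A m).card = 2 ∧ (B m).card = 2 ∧ (C m).card = 2 :=
  by obtain ⟨σ, τ, υ, h⟩ := exists_isTSF_five_zmod13; exact exists_isSTPP_222pow_mul_of_tsf exists_isSTPP_222penta_seed_2_2_2_3_3 h

end SmallTSF

/-! ## Correction and sharper corollaries (same seat, 11:2xZ): `n₃ = 32`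

The module docstring and the `k = 6, 12, 15` corollaries above use the order-40 seed `(ℤ/2)³ × ℤ/5` for `(2,2,2)³` and quote
"census onsets `n₂..n₅ = 24, 40, 56, ≤ 72`".  Per ENG2's correction in `STPP222PentaOrder72.lean` ("Correction … `n₃ = 32`")
the order-32 group `(ℤ/2)⁵` already admits `(2,2,2)³` (`exists_isSTPP_222cube_zmod2_pow5`, `STPP222CubeBelow46.lean`), so the
census onset is `n₃ = 32` and `40, 56, 72` are to be read as witness orders (upper bounds for `n₃, n₄, n₅`).  The theorems above
stand as stated; the products below replace the order-40 seed by the order-32 one: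
`(2,2,2)⁶ ⊆ (ℤ/2)⁵ × ℤ/3` (order `96`), `(2,2,2)¹² ⊆ (ℤ/2)⁵ × (ℤ/3)²` (order `288`), `(2,2,2)¹⁵ ⊆ (ℤ/2)⁵ × ℤ/13` (order `416`),
`(2,2,2)²⁷ ⊆ (ℤ/2)⁵ × (ℤ/3)³` (order `864`). -/

section SharperCorollaries

/-- **`(2,2,2)⁶` at order `96`:** the order-32 seed `(ℤ/2)⁵` times the 2-element TSF set of `ℤ/3` (cyclic law: `248`).
[cite: CohnKleinbergSzegedyUmans2005, Def. 5.1] -/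
theorem exists_isSTPP_222pow6_order96 :
    ∃ A B C : Fin (3 * 2) → Finset ((ZMod 2 × ZMod 2 × ZMod 2 × ZMod 2 × ZMod 2) × ZMod 3), IsSTPP A B C ∧
      ∀ m, (A m).card = 2 ∧ (B m).card = 2 ∧ (C m).card = 2 :=
  by obtain ⟨v, hv⟩ := exists_isTSF_two_zmod3; exact exists_isSTPP_222pow_mul_of_tsf exists_isSTPP_222cube_zmod2_pow5 hv

/-- **`(2,2,2)¹²` at order `288`:** the order-32 seed times the 4-point cap set of `(ℤ/3)²` (cyclic law: `1064`).
[cite: CohnKleinbergSzegedyUmans2005, Def. 5.1] -/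
theorem exists_isSTPP_222pow12_order288 :
    ∃ A B C : Fin (3 * 4) → Finset ((ZMod 2 × ZMod 2 × ZMod 2 × ZMod 2 × ZMod 2) × (ZMod 3 × ZMod 3)), IsSTPP A B C ∧
      ∀ m, (A m).card = 2 ∧ (B m).card = 2 ∧ (C m).card = 2 :=
  by obtain ⟨v, hv⟩ := exists_isTSF_four_zmod3_sq; exact exists_isSTPP_222pow_mul_of_tsf exists_isSTPP_222cube_zmod2_pow5 hv

/-- **`(2,2,2)¹⁵` at order `416`:** the order-32 seed times the 5-element TSF set of `ℤ/13` (cyclic law: `1688`).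
[cite: CohnKleinbergSzegedyUmans2005, Def. 5.1] -/
theorem exists_isSTPP_222pow15_order416 :
    ∃ A B C : Fin (3 * 5) → Finset ((ZMod 2 × ZMod 2 × ZMod 2 × ZMod 2 × ZMod 2) × ZMod 13), IsSTPP A B C ∧
      ∀ m, (A m).card = 2 ∧ (B m).card = 2 ∧ (C m).card = 2 :=
  by obtain ⟨σ, τ, υ, h⟩ := exists_isTSF_five_zmod13; exact exists_isSTPP_222pow_mul_of_tsf exists_isSTPP_222cube_zmod2_pow5 h

/-- **`(2,2,2)²⁷` at order `864`:** the order-32 seed times the 9-point cap set of `(ℤ/3)³` (cyclic law: `5624`).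
[cite: CohnKleinbergSzegedyUmans2005, Def. 5.1] -/
theorem exists_isSTPP_222pow27_order864 :
    ∃ A B C : Fin (3 * 9) → Finset ((ZMod 2 × ZMod 2 × ZMod 2 × ZMod 2 × ZMod 2) × (ZMod 3 × ZMod 3 × ZMod 3)), IsSTPP A B C ∧
      ∀ m, (A m).card = 2 ∧ (B m).card = 2 ∧ (C m).card = 2 :=
  by obtain ⟨v, hv⟩ := exists_isTSF_nine_zmod3_cube; exact exists_isSTPP_222pow_mul_of_tsf exists_isSTPP_222cube_zmod2_pow5 hv

/-- Orders of the sharper host groups: `96, 288, 416, 864`. -/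
theorem card_sharper_hosts :
    Fintype.card ((ZMod 2 × ZMod 2 × ZMod 2 × ZMod 2 × ZMod 2) × ZMod 3) = 96 ∧
    Fintype.card ((ZMod 2 × ZMod 2 × ZMod 2 × ZMod 2 × ZMod 2) × (ZMod 3 × ZMod 3)) = 288 ∧
    Fintype.card ((ZMod 2 × ZMod 2 × ZMod 2 × ZMod 2 × ZMod 2) × ZMod 13) = 416 ∧
    Fintype.card ((ZMod 2 × ZMod 2 × ZMod 2 × ZMod 2 × ZMod 2) × (ZMod 3 × ZMod 3 × ZMod 3)) = 864 := by
  simp only [Fintype.card_prod, ZMod.card]; norm_num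

end SharperCorollaries

end Summit.MatrixMultiplication.OmegaCensus
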